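import Mathlib.Algebra.Colimit.Ring
import Mathlib.FieldTheory.IsAlgClosed.Basic
import Mathlib.SetTheory.Cardinal.Basic
import Literature.ModelTheory.ExponentialFields.ExponentialField
import HarnessLib

/-!
# Direct limits of exponential fields along E-field embeddings

For a directed system of exponential fields `G i` (`i : ι`, `ι` a nonempty directed preorder)
with E-ring morphisms `φ i j : G i → G j` (`i ≤ j`) forming a `DirectedSystem`, Mathlib's ring
direct limit `Ring.DirectLimit G φ` is a field (`Field.DirectLimit.field`); we equip it with the
exponential `exp [x]_i = [exp x]_i` (well defined because the `φ i j` commute with `exp` and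
are injective) and record the elementary transfer statements used to build uncountable
exponential fields as unions of chains / directed systems of countable ones (van den Dries 1984
§1: E-rings form a category with directed colimits computed on underlying sets; Kirby 2010
*On quasiminimal excellent classes* Thm 4.2 and Bays–Kirby 2018 Thm 8.2: "all the axioms are
preserved under unions of directed systems of closed embeddings"):

* `instExponentialRing` — the exponential on the limit; `exp_of`;
* `of_injective'`, `charZero`, `exists_of₂` (common chart for two elements);
* `isAlgClosed` — a directed union of algebraically closed fields is algebraically closed;
* `isSurjectiveOntoUnits` — surjectivity of `exp` onto the units transfers;
* `mem_expKernel_iff` — the kernel of the limit is the union of the kernels;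
* `mk_le` — `#(lim) ≤ #ι * sup #G i` in the constant case `#(lim) ≤ #ι * #M`.

## References

* L. van den Dries, *Exponential rings, exponential polynomials and exponential functions*,
  Pacific J. Math. 113 (1984), §1.
* J. Kirby, *On quasiminimal excellent classes*, J. Symbolic Logic 75 (2010), Thm 4.2.
* M. Bays, J. Kirby, *Pseudo-exponential maps, variants, and quasiminimality*, Algebra & Number
  Theory 12 (2018), Thm 8.2 (proof: preservation under directed unions).
-/

noncomputable section

suppress_compilation

open Cardinal

universe u v

namespace Literature.ModelTheory.ExponentialFields

namespace ExpDirectLimit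

variable {ι : Type u} [Preorder ι] [Nonempty ι] [IsDirectedOrder ι]
variable {G : ι → Type v} [∀ i, Field (G i)] [∀ i, ExponentialRing (G i)]
variable (φ : ∀ i j, i ≤ j → ExponentialRingHom (G i) (G j))

/-- The underlying ring homomorphisms of the system. [folklore] -/
abbrev ringHoms : ∀ i j, i ≤ j → G i →+* G j := fun i j h => (φ i j h).toRingHom

/-- The direct limit of the exponential fields `G i` along the E-ring morphisms `φ`
(as a commutative ring: Mathlib's `Ring.DirectLimit`). [folklore] -/
abbrev Lim : Type (max u v) := Ring.DirectLimit G fun i j h => ringHoms φ i j h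

/-- The structure maps into the limit. [folklore] -/
abbrev of (i : ι) : G i →+* Lim φ := Ring.DirectLimit.of G (fun i j h => ringHoms φ i j h) i

variable [DirectedSystem G fun i j h => ringHoms φ i j h]

/-- The limit of fields is a field (Mathlib). [folklore] -/
instance instField : Field (Lim φ) := Field.DirectLimit.field G fun i j h => ringHoms φ i j h

omit [Nonempty ι] in
/-- The structure maps are injective (field homomorphisms are injective). [folklore] -/
theorem of_injective' (i : ι) : Function.Injective (of φ i) :=
  Ring.DirectLimit.of_injective (fun i j h => ringHoms φ i j h)
    (fun i j h => (ringHoms φ i j h).injective) i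

omit [DirectedSystem G fun i j h => ringHoms φ i j h] in
/-- Every element of the limit comes from some chart. [folklore] -/
theorem exists_of (z : Lim φ) : ∃ i x, of φ i x = z := Ring.DirectLimit.exists_of z

omit [Nonempty ι] [IsDirectedOrder ι] [DirectedSystem G fun i j h => ringHoms φ i j h] in
/-- Compatibility of the structure maps with the system. [folklore] -/
@[simp] theorem of_φ {i j : ι} (h : i ≤ j) (x : G i) : of φ j (φ i j h x) = of φ i x :=
  Ring.DirectLimit.of_f (G := G) (f := fun i j h => ringHoms φ i j h) h x

omit [DirectedSystem G fun i j h => ringHoms φ i j h] in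
/-- Two elements of the limit come from a common chart. [folklore] -/
theorem exists_of₂ (z w : Lim φ) : ∃ i x y, of φ i x = z ∧ of φ i y = w := by
  obtain ⟨i, x, rfl⟩ := exists_of φ z
  obtain ⟨j, y, rfl⟩ := exists_of φ w
  obtain ⟨k, hik, hjk⟩ := exists_ge_ge i j
  exact ⟨k, φ i k hik x, φ j k hjk y, of_φ φ hik x, of_φ φ hjk y⟩

omit [Nonempty ι] in
/-- Equality in the limit is equality in a common later chart. [folklore] -/
theorem of_eq_of_iff {i j : ι} (x : G i) (y : G j) :
    of φ i x = of φ j y ↔ ∃ k, ∃ hik : i ≤ k, ∃ hjk : j ≤ k, φ i k hik x = φ j k hjk y := by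
  constructor
  · intro h
    obtain ⟨k, hik, hjk⟩ := exists_ge_ge i j
    refine ⟨k, hik, hjk, of_injective' φ k ?_⟩
    rw [of_φ, of_φ, h]
  · rintro ⟨k, hik, hjk, h⟩
    rw [← of_φ φ hik x, ← of_φ φ hjk y, h]

/-! ### The exponential on the limit -/

/-- The exponential on the limit, defined chartwise by choice. [folklore] -/
def expLim (z : Lim φ) : Lim φ :=
  of φ (Classical.choose (exists_of φ z))
    (ExponentialRing.exp (Classical.choose (Classical.choose_spec (exists_of φ z))))

/-- The chartwise exponential is well defined: `exp [x]_i = [exp x]_i`. [folklore] -/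
theorem expLim_of (i : ι) (x : G i) : expLim φ (of φ i x) = of φ i (ExponentialRing.exp x) := by
  unfold expLim
  set j := Classical.choose (exists_of φ (of φ i x)) with hj
  have hy := Classical.choose_spec (Classical.choose_spec (exists_of φ (of φ i x)))
  set y := Classical.choose (Classical.choose_spec (exists_of φ (of φ i x))) with hy'
  -- `of j y = of i x`, so `y` and `x` agree in a common chart
  obtain ⟨k, hjk, hik, hxy⟩ := (of_eq_of_iff φ y x).1 hy
  rw [← of_φ φ hjk, ← of_φ φ hik (ExponentialRing.exp x), ExponentialRingHom.map_exp,
    ExponentialRingHom.map_exp, hxy]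

/-- **The direct limit of exponential fields is an exponential field.**
[cite: Dries1984, §1] -/
instance instExponentialRing : ExponentialRing (Lim φ) where
  exp := expLim φ
  exp_zero := by
    obtain ⟨i⟩ := ‹Nonempty ι›
    rw [← (of φ i).map_zero, expLim_of, ExponentialRing.exp_zero, map_one]
  exp_add z w := by
    obtain ⟨i, x, y, rfl, rfl⟩ := exists_of₂ φ z w
    rw [← map_add, expLim_of, expLim_of, expLim_of, ExponentialRing.exp_add, map_mul]

/-- `exp [x]_i = [exp x]_i`. [folklore] -/
@[simp] theorem exp_of (i : ι) (x : G i) :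
    ExponentialRing.exp (of φ i x) = of φ i (ExponentialRing.exp x) :=
  expLim_of φ i x

/-- The structure maps are E-ring morphisms. [folklore] -/
def ofExp (i : ι) : ExponentialRingHom (G i) (Lim φ) where
  toRingHom := of φ i
  map_exp' x := (exp_of φ i x).symm

/-- Unfolding `ofExp`. [folklore] -/
@[simp] theorem ofExp_apply (i : ι) (x : G i) : ofExp φ i x = of φ i x := rfl

/-! ### Transfer -/

/-- Characteristic zero transfers to the limit. [folklore] -/
theorem charZero [∀ i, CharZero (G i)] : CharZero (Lim φ) := by
  obtain ⟨i⟩ := ‹Nonempty ι›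
  refine ⟨fun m n h => ?_⟩
  have : of φ i (m : G i) = of φ i (n : G i) := by rw [map_natCast, map_natCast]; exact h
  exact Nat.cast_injective (of_injective' φ i this)

/-- **A directed union of algebraically closed fields is algebraically closed.** [folklore] -/
theorem isAlgClosed [∀ i, IsAlgClosed (G i)] : IsAlgClosed (Lim φ) := by
  refine IsAlgClosed.of_exists_root _ fun p hmonic hirr => ?_
  obtain ⟨i, q, hq⟩ :=
    Ring.DirectLimit.Polynomial.exists_of (f' := fun i j h => ringHoms φ i j h) p
  have hdeg : q.degree = p.degree := by
    rw [← hq, Polynomial.degree_map_eq_of_injective (of_injective' φ i)]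
  have hp : p.degree ≠ 0 := fun h0 =>
    hirr.not_isUnit (Polynomial.isUnit_iff_degree_eq_zero.2 h0)
  have hq' : q.degree ≠ 0 := by rwa [hdeg]
  obtain ⟨r, hr⟩ := IsAlgClosed.exists_root q hq'
  refine ⟨of φ i r, ?_⟩
  show Polynomial.eval (of φ i r) p = 0
  rw [← hq, Polynomial.eval_map, Polynomial.eval₂_hom, show Polynomial.eval r q = 0 from hr,
    map_zero]

/-- Surjectivity of `exp` onto the nonzero elements transfers to the limit. [folklore] -/
theorem isSurjectiveOntoUnits (h : ∀ i, ExponentialRing.IsSurjectiveOntoUnits (G i)) :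
    ExponentialRing.IsSurjectiveOntoUnits (Lim φ) := by
  intro y hy
  obtain ⟨i, x, rfl⟩ := exists_of φ y
  have hx : x ≠ 0 := fun hx => hy (by rw [hx, map_zero])
  obtain ⟨w, hw⟩ := h i x hx
  exact ⟨of φ i w, by rw [exp_of, hw]⟩

/-- The kernel of the exponential of the limit is the union of the kernels of the charts.
[folklore] -/
theorem mem_expKernel_iff (z : Lim φ) :
    z ∈ ExponentialRing.expKernel (Lim φ) ↔
      ∃ i x, x ∈ ExponentialRing.expKernel (G i) ∧ of φ i x = z := by
  constructor
  · intro hz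
    obtain ⟨i, x, rfl⟩ := exists_of φ z
    refine ⟨i, x, ?_, rfl⟩
    rw [ExponentialRing.mem_expKernel_iff] at hz ⊢
    rw [exp_of] at hz
    exact of_injective' φ i (by rw [hz, map_one])
  · rintro ⟨i, x, hx, rfl⟩
    rw [ExponentialRing.mem_expKernel_iff] at hx ⊢
    rw [exp_of, hx, map_one]

end ExpDirectLimit

namespace ExpDirectLimit

variable {ι : Type u} [Preorder ι] [Nonempty ι] [IsDirectedOrder ι]
variable {M : Type u} [Field M] [ExponentialRing M]
variable (ψ : ∀ i j : ι, i ≤ j → ExponentialRingHom M M)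

/-- The limit of a system of self-embeddings of `M` indexed by `ι` has at most `#ι * #M`
elements. [folklore] -/
theorem mk_le_of_const : #(Lim (G := fun _ => M) ψ) ≤ #ι * #M := by
  have hsurj : Function.Surjective (fun p : ι × M => of (G := fun _ => M) ψ p.1 p.2) := by
    intro z
    obtain ⟨i, x, rfl⟩ := exists_of (G := fun _ => M) ψ z
    exact ⟨(i, x), rfl⟩
  simpa [Cardinal.mk_prod, Cardinal.lift_id] using Cardinal.mk_le_of_surjective hsurj

end ExpDirectLimit

end Literature.ModelTheory.ExponentialFields

end
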